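import Summits.SmoothPoincare4.SmoothPoincare4.Theorems.CongruenceShadowsShadowApproximationStubLayerStepOneZeroReading
import Summits.SmoothPoincare4.SmoothPoincare4.Theorems.CongruenceShadowsShadowApproximationStubAutAbelianizeSymplectic
import HarnessLib

/-!
# Helper `helper_layerStepOfCore` for stub `stub_nilpotentLayerStep` (line `nilpotent-genus-class`,
crux `CongruenceShadows.ShadowApproximation`, item stmt-SmoothPoincare4-14595):
# the uniform reduction of the layer step to IA-normalised pairs

`S = SurfaceGroup (3+3m)`, `N i = s4Kernels.stabilizeIter m i`, `γₖ₊₁ = (⊤).lowerCentralSeries k`.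
The layer step at `(m, c)` reads: if `K₂ = α(N₂) = β(N₂)` with `α ∈ Stab N₀`, `β ∈ Stab N₁` and
`K₂ γ_{c+2} = N₂ γ_{c+2}`, then some `y ∈ Stab N₀ ∩ Stab N₁` has `y(N₂ γ_{c+3}) = K₂ γ_{c+3}`.
`LayerCore (m, c)` is the same statement for IA-NORMALISED pairs: `φ` IA with `φ(N₀) = N₀`,
`φ(N₂) = P` and `ψ` IA with `ψ(N₁) = N₁`, `ψ(N₂) = P`.

* `exists_ia_of_pair_stabilizeIter_keep` — **pair normalisation keeping the stabilised slot** at every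
  genus `3 + 3m` and for both slot pairs `(0, 2)`, `(1, 2)`: from `α ∈ Stab Nᵢ` (`i ≠ 2`) with
  `α(N₂) = P`, `P γ₂ = N₂ γ₂`, the automorphism `α' = α ∘ x⁻¹` — `x ∈ Stab Nᵢ ∩ Stab N₂` a Goeritz
  realiser of the `±`-isometry `ᾱ` of `H₁` (landed `stub_autAbelianizeSymplectic`; `ᾱ` stabilises
  `Λᵢ`, `Λ₂`) from the landed coordinate-pair Goeritz realisation `exists_goeritz_realises` — is IA,
  stabilises `Nᵢ` and carries `N₂` onto `P`.
* `helper_layerStepOfCore` — the registered helper: `LayerCore (m, c) → LayerFromPairs (m, c)`.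
No definitions, no hypotheses beyond the landed facts.
-/

set_option linter.dupNamespace false

noncomputable section

open Subgroup Literature.Topology.FourManifolds Literature.Algebra.Lie Multiplicative
open Summit.SmoothPoincare4.SmoothPoincare4.Theorems.NilpotentShadowsStandard.SaturatedTorsorDescent

namespace Summit.SmoothPoincare4.SmoothPoincare4.Theorems.ShadowApproximation.NilpotentGenusClass

variable {m : ℕ}

/-- **Pair normalisation keeping the stabilised slot, genus `3 + 3m`.** For `i ≠ 2`: if `α ∈ Stab Nᵢ`
carries `N₂` onto `P` and `P γ₂ = N₂ γ₂`, then some IA-automorphism `α'` stabilises `Nᵢ` and carries `N₂`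
onto `P` (`α' = α ∘ x⁻¹` for a realiser `x ∈ Stab Nᵢ ∩ Stab N₂` of `ᾱ`, from the landed coordinate-pair
Goeritz realisation and the landed `±`-symplecticity of `Aut S`). [folklore] -/
theorem exists_ia_of_pair_stabilizeIter_keep {i : Fin 3} (hi : i ≠ 2)
    {P : Subgroup (SurfaceGroup (3 + 3 * m))} {α : SurfaceGroup (3 + 3 * m) ≃* SurfaceGroup (3 + 3 * m)}
    (hαi : (s4Kernels.stabilizeIter m i).map α.toMonoidHom = s4Kernels.stabilizeIter m i)
    (hα2 : (s4Kernels.stabilizeIter m 2).map α.toMonoidHom = P)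
    (hP : P ⊔ ((⊤ : Subgroup (SurfaceGroup (3 + 3 * m))).lowerCentralSeries 1) =
      s4Kernels.stabilizeIter m 2 ⊔ ((⊤ : Subgroup (SurfaceGroup (3 + 3 * m))).lowerCentralSeries 1)) :
    ∃ α' : SurfaceGroup (3 + 3 * m) ≃* SurfaceGroup (3 + 3 * m),
      (∀ s, α' s * s⁻¹ ∈ ((⊤ : Subgroup (SurfaceGroup (3 + 3 * m))).lowerCentralSeries 1)) ∧
      (s4Kernels.stabilizeIter m i).map α'.toMonoidHom = s4Kernels.stabilizeIter m i ∧
      (s4Kernels.stabilizeIter m 2).map α'.toMonoidHom = P := by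
  -- adapted from the landed `exists_ia_of_pair_stabilizeIter` (…StubLayerStepOneZeroReading), keeping slot `i`
  obtain ⟨F, ε, hε, hF, hiso⟩ := stub_autAbelianizeSymplectic (3 + 3 * m) α
  have hΛi := map_Λ_stabilizeIter_of_map_eq α F hF hαi
  have hΛ2 := map_Λ_stabilizeIter_of_map_sup_eq α F hF hα2 hP
  rw [span_single_s4CutSystem] at hΛi hΛ2
  have hi' : (i : ℕ) = 0 ∨ (i : ℕ) = 1 := by
    have h3 := i.isLt
    have h2 : (i : ℕ) ≠ 2 := fun h => hi (Fin.ext h)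
    omega
  have hi2 : ∀ j : Fin (3 + 3 * m), decide (((j : ℕ) + ((i : Fin 3) : ℕ)) % 3 = 2) = true →
      decide (((j : ℕ) + ((2 : Fin 3) : ℕ)) % 3 = 2) = false := by
    intro j
    simp only [Fin.val_two, decide_eq_true_eq, decide_eq_false_iff_not]
    omega
  obtain ⟨x, hxi, hx2, hx⟩ := exists_goeritz_realises _ _ hi2 F ε hε hiso
    (coords_of_map_span_eq _ F hΛi) (coords_of_map_span_eq _ F hΛ2)
  rw [← stabilizeIter_eq_cutKernel] at hxi hx2
  have hab_symm : ∀ s, toAdd (SurfaceGroup.abelianize (3 + 3 * m) (x.symm s)) =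
      F.symm (toAdd (SurfaceGroup.abelianize (3 + 3 * m) s)) := fun s => by
    rw [eq_comm, LinearEquiv.symm_apply_eq, ← hx, MulEquiv.apply_symm_apply]
  refine ⟨x.symm.trans α, fun s => mul_inv_mem_lcs_one_of_ab_eq ?_, ?_, ?_⟩
  · rw [MulEquiv.trans_apply, hF, hab_symm, LinearEquiv.apply_symm_apply]
  · rw [map_trans, map_symm_of_map x hxi, hαi]
  · rw [map_trans, map_symm_of_map x hx2, hα2]

/-- `P γ_{c+2} = N₂ γ_{c+2}` implies `P γ₂ = N₂ γ₂` (`γ_{c+2} ≤ γ₂`). [folklore] -/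
theorem sup_lcs_one_eq_of_sup_lcs_succ_eq {c : ℕ} {P : Subgroup (SurfaceGroup (3 + 3 * m))}
    (hP : P ⊔ ((⊤ : Subgroup (SurfaceGroup (3 + 3 * m))).lowerCentralSeries (c + 1)) =
      s4Kernels.stabilizeIter m 2 ⊔ ((⊤ : Subgroup (SurfaceGroup (3 + 3 * m))).lowerCentralSeries (c + 1))) :
    P ⊔ ((⊤ : Subgroup (SurfaceGroup (3 + 3 * m))).lowerCentralSeries 1) =
      s4Kernels.stabilizeIter m 2 ⊔ ((⊤ : Subgroup (SurfaceGroup (3 + 3 * m))).lowerCentralSeries 1) := by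
  -- adapted from the `hK2'` step of the landed `stub_layerStepZeroOne`
  have e : ∀ Q : Subgroup (SurfaceGroup (3 + 3 * m)), Q ⊔ ((⊤ : Subgroup (SurfaceGroup (3 + 3 * m))).lowerCentralSeries 1) =
      (Q ⊔ ((⊤ : Subgroup (SurfaceGroup (3 + 3 * m))).lowerCentralSeries (c + 1))) ⊔
        ((⊤ : Subgroup (SurfaceGroup (3 + 3 * m))).lowerCentralSeries 1) :=
    fun Q => by rw [sup_assoc, sup_eq_right.2 (lcs_antitone (Nat.le_add_left 1 c))]
  rw [e P, hP, ← e]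

/-! ## Registered helper -/

/-- **Registered helper `helper_layerStepOfCore`** (sub-goal of stub `stub_nilpotentLayerStep`, crux
stmt-SmoothPoincare4-14595): the uniform, crux-independent reduction `LayerCore (m, c) → LayerFromPairs (m, c)`
of the layer step at `(m, c)` to IA-normalised pairs — the Waldhausen pairs `α ∈ Stab N₀`, `β ∈ Stab N₁` with
`α(N₂) = β(N₂) = K₂`, `K₂ γ_{c+2} = N₂ γ_{c+2}` are replaced by IA-automorphisms `φ ∈ Stab N₀`, `ψ ∈ Stab N₁`
with `φ(N₂) = ψ(N₂) = K₂` (`exists_ia_of_pair_stabilizeIter_keep` for the slot pairs `(0,2)` and `(1,2)`),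
and the hypothesis `LayerCore` is applied. [folklore] -/
theorem helper_layerStepOfCore : ∀ (m c : ℕ), (∀ (P : Subgroup (Literature.Topology.FourManifolds.SurfaceGroup (3 + 3 * m))) (φ ψ : Literature.Topology.FourManifolds.SurfaceGroup (3 + 3 * m) ≃* Literature.Topology.FourManifolds.SurfaceGroup (3 + 3 * m)), (∀ s : Literature.Topology.FourManifolds.SurfaceGroup (3 + 3 * m), φ s * s⁻¹ ∈ (⊤ : Subgroup (Literature.Topology.FourManifolds.SurfaceGroup (3 + 3 * m))).lowerCentralSeries 1) → (Literature.Topology.FourManifolds.s4Kernels.stabilizeIter m 0).map φ.toMonoidHom = Literature.Topology.FourManifolds.s4Kernels.stabilizeIter m 0 → (Literature.Topology.FourManifolds.s4Kernels.stabilizeIter m 2).map φ.toMonoidHom = P → (∀ s : Literature.Topology.FourManifolds.SurfaceGroup (3 + 3 * m), ψ s * s⁻¹ ∈ (⊤ : Subgroup (Literature.Topology.FourManifolds.SurfaceGroup (3 + 3 * m))).lowerCentralSeries 1) → (Literature.Topology.FourManifolds.s4Kernels.stabilizeIter m 1).map ψ.toMonoidHom = Literature.Topology.FourManifolds.s4Kernels.stabilizeIter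 m 1 → (Literature.Topology.FourManifolds.s4Kernels.stabilizeIter m 2).map ψ.toMonoidHom = P → P ⊔ (⊤ : Subgroup (Literature.Topology.FourManifolds.SurfaceGroup (3 + 3 * m))).lowerCentralSeries (c + 1) = Literature.Topology.FourManifolds.s4Kernels.stabilizeIter m 2 ⊔ (⊤ : Subgroup (Literature.Topology.FourManifolds.SurfaceGroup (3 + 3 * m))).lowerCentralSeries (c + 1) → ∃ y : Literature.Topology.FourManifolds.SurfaceGroup (3 + 3 * m) ≃* Literature.Topology.FourManifolds.SurfaceGroup (3 + 3 * m), (Literature.Topology.FourManifolds.s4Kernels.stabilizeIter m 0).map y.toMonoidHom = Literature.Topology.FourManifolds.s4Kernels.stabilizeIter m 0 ∧ (Literature.Topology.FourManifolds.s4Kernels.stabilizeIter m 1).map y.toMonoidHom = Literature.Topology.FourManifolds.s4Kernels.stabilizeIter m 1 ∧ (Literature.Topology.FourManifolds.s4Kernels.stabilizeIter m 2 ⊔ (⊤ : Subgroup (Literature.Topology.FourManifolds.SurfaceGroup (3 + 3 * m))).lowerCentralSeries (c + 1 + 1)).map y.toMonoidHom = P ⊔ (⊤ : Subgroup (Literature.Topology.FourManifolds.SurfaceGroup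 (3 + 3 * m))).lowerCentralSeries (c + 1 + 1)) → ∀ (K₂ : Subgroup (Literature.Topology.FourManifolds.SurfaceGroup (3 + 3 * m))), (∃ α : Literature.Topology.FourManifolds.SurfaceGroup (3 + 3 * m) ≃* Literature.Topology.FourManifolds.SurfaceGroup (3 + 3 * m), (Literature.Topology.FourManifolds.s4Kernels.stabilizeIter m 0).map α.toMonoidHom = Literature.Topology.FourManifolds.s4Kernels.stabilizeIter m 0 ∧ (Literature.Topology.FourManifolds.s4Kernels.stabilizeIter m 2).map α.toMonoidHom = K₂) → (∃ β : Literature.Topology.FourManifolds.SurfaceGroup (3 + 3 * m) ≃* Literature.Topology.FourManifolds.SurfaceGroup (3 + 3 * m), (Literature.Topology.FourManifolds.s4Kernels.stabilizeIter m 1).map β.toMonoidHom = Literature.Topology.FourManifolds.s4Kernels.stabilizeIter m 1 ∧ (Literature.Topology.FourManifolds.s4Kernels.stabilizeIter m 2).map β.toMonoidHom = K₂) → K₂ ⊔ (⊤ : Subgroup (Literature.Topology.FourManifolds.SurfaceGroup (3 + 3 * m))).lowerCentralSeries (c + 1) = Literature.Topology.FourManifolds.s4Kernels.stabilizeIter m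 2 ⊔ (⊤ : Subgroup (Literature.Topology.FourManifolds.SurfaceGroup (3 + 3 * m))).lowerCentralSeries (c + 1) → ∃ y : Literature.Topology.FourManifolds.SurfaceGroup (3 + 3 * m) ≃* Literature.Topology.FourManifolds.SurfaceGroup (3 + 3 * m), (Literature.Topology.FourManifolds.s4Kernels.stabilizeIter m 0).map y.toMonoidHom = Literature.Topology.FourManifolds.s4Kernels.stabilizeIter m 0 ∧ (Literature.Topology.FourManifolds.s4Kernels.stabilizeIter m 1).map y.toMonoidHom = Literature.Topology.FourManifolds.s4Kernels.stabilizeIter m 1 ∧ (Literature.Topology.FourManifolds.s4Kernels.stabilizeIter m 2 ⊔ (⊤ : Subgroup (Literature.Topology.FourManifolds.SurfaceGroup (3 + 3 * m))).lowerCentralSeries (c + 1 + 1)).map y.toMonoidHom = K₂ ⊔ (⊤ : Subgroup (Literature.Topology.FourManifolds.SurfaceGroup (3 + 3 * m))).lowerCentralSeries (c + 1 + 1) := by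
  intro m c hCore K₂ hα hβ hlev
  obtain ⟨α, hα0, hα2⟩ := hα
  obtain ⟨β, hβ1, hβ2⟩ := hβ
  have hK2' := sup_lcs_one_eq_of_sup_lcs_succ_eq hlev
  obtain ⟨φ, hφ, hφ0, hφ2⟩ := exists_ia_of_pair_stabilizeIter_keep (i := 0) (by decide) hα0 hα2 hK2'
  obtain ⟨ψ, hψ, hψ1, hψ2⟩ := exists_ia_of_pair_stabilizeIter_keep (i := 1) (by decide) hβ1 hβ2 hK2'
  exact hCore K₂ φ ψ hφ hφ0 hφ2 hψ hψ1 hψ2 hlev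

end Summit.SmoothPoincare4.SmoothPoincare4.Theorems.ShadowApproximation.NilpotentGenusClass

end
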